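import Summits.FinalStateConjecture.FinalStateConjecture.Theses.RootDecompSobolevLedgerCells

/-!
# `RootDecompSobolevLedgerCells.RoughTailExitGlue` (stmt-FinalStateConjecture-29970) — proof

Stand-alone proof (imports only the route file) of the GLUE support item of the gen-1 split of
`RootDecompSobolevLedgerCells.RoughTailExit` (stmt-FinalStateConjecture-29291, the rough-tail no-account cell)
into its two cells `SobolevAccountDoor` (stmt-29968, sole-end tail in the Chruściel–Bieri weighted-Sobolev
class) and `SubSobolevTailExit` (stmt-29969, tail outside it): children ⟹ parent. Written by a planner lens
seat of the decomp-fsc cell (lens-5 «finite range + asymptotic regime + bridge», generations 7 and 23; the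
in-HOME kernel version is `SobolevLedgerCells.rough_of_cells`, lens-5 g7) for a prover seat to file;
re-proved here directly on the tree decls without the lens's cell vocabulary.

Statement (the tree decl, BY NAME): `SobolevAccountDoor → SubSobolevTailExit → RoughTailExit`.

Proof: the three decls share the same `let`-bound predicates `P`, `Pw0`, `Disp`, `Trap`, `Cens`, `Single`,
`CenFinF` (the cell 𝓒_B), `MassF`, `AreaF`, `Acc`, `KN` and the children moreover `ST` (some sole-end chart
has a weighted-Sobolev tail with parity); the parent asks for a tame admissible exit through `P` at every
admissible `P`-exceptional datum of 𝓒_B with `¬Acc ∧ ¬KN`, the children ask for it on the sub-populations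
`(¬Acc ∧ ¬KN) ∧ ST` and `(¬Acc ∧ ¬KN) ∧ ¬ST`, which exhaust it by one excluded middle. Pure logic; no geometry
is used.
-/

-- D-0017: single-problem summit, `Summit.<S>.<S>.…` by design (cf. lakefile `weak.linter.dupNamespace`).
set_option linter.dupNamespace false

namespace Summit.FinalStateConjecture.FinalStateConjecture.Theorems.RootDecompSobolevLedgerCellsRoughTailExitGlue

/-- **Glue of the Sobolev-ledger split** (stmt-FinalStateConjecture-29970, BY NAME): if the weighted-Sobolev
door and the sub-Sobolev-tail cell each admit tame admissible exits through the summit property, then so does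
the whole rough-tail cell — the two cells exhaust it by excluded middle on «some sole-end chart has a
weighted-Sobolev tail with parity». -/
theorem roughTailExitGlue : Theses.RootDecompSobolevLedgerCells.RoughTailExitGlue := by
  intro hDoor hRes X _ _ _ _ _ _
  have hDoor' := hDoor X
  have hRes' := hRes X
  dsimp only at hDoor' hRes' ⊢
  intro d hd hnP hB hcell
  exact (Classical.em _).elim (fun hST ↦ hDoor' d hd hnP hB ⟨hcell, hST⟩)
    fun hST ↦ hRes' d hd hnP hB ⟨hcell, hST⟩

end Summit.FinalStateConjecture.FinalStateConjecture.Theorems.RootDecompSobolevLedgerCellsRoughTailExitGlue
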